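import Summits.BirchSwinnertonDyer.BirchSwinnertonDyer.Theorems.PrintCFramJZeroThreeUnitRegimeValuePsi
import Summits.BirchSwinnertonDyer.BirchSwinnertonDyer.Theorems.PrintCFramJZeroThreeUnitRegimeValuePsiBernoulliOdd
import Summits.BirchSwinnertonDyer.BirchSwinnertonDyer.Theorems.PrintCFramJZeroThreeUnitRegimeKroneckerCharacters
import Summits.BirchSwinnertonDyer.Rank1Residual.X12.O11.RouteUEulerCriterionNat
import HarnessLib


/-! # K12r@3 — the «3-unit regime» CLASS THEOREMS for `ψ = χ₄₄` (`d* = 11`; classes `17424bb`,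
# `17424be`, `17424bf`; Heegner field `ℚ(√−263)`) and the ODD Legendre character `ψ = (·/7)`
# (`d* = −7`; classes `1323m`, `11907r`, `11907s`, `11907t`; Heegner field `ℚ(√−47)`): instances of
# `bsdp_three_of_unitRegime_valuePsi` with the Bernoulli certificates DECIDED (cell `bsd-print-cfram`,
# seat p3 g2; regime N = `TorsionFreeFrameBSDThree`, stmt-BirchSwinnertonDyer-20698; P3-UNIT-REGIME-CENSUS §3)

HONEST FRAMING (cell `bsd-print-cfram`, run/shared/lean/pub/bsd-print-cfram/, D-0131 (2) print
tier; verbatim in every file of the cell): the cell works the partition leaf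
`CornerF ∧ p ramified in the CM field K` (LADDER-BSD row K7r = B13; W-ALL row 12r) in PARTITION
currency — a leaf or a cell counts only when its theorem is in the kernel BY NAME. Nothing here is a
Literature statement, no named fact is introduced, nothing is asserted about BSD; beyond-print: NO
(Kriz–Li 2019 Thm. 1.20 + Rem. 3.10 at `p = 3`, §10.3's mechanism; finite certificates by `decide`;
THEOREMS ONLY).

* §1 `ψ = χ₄₄ = χ₋₄↑(·/11)↑` (EVEN, conductor `44`), `K = ℚ(√−263)` (`2`, `3`, `11` split): certificates
  `3 ∤ Σ_{j<11572} χ₄(j)(j/11)(j/263)j = −185152` and `3 ∥ Σ_{j<132} χ₄(j)(j/11)(j/3)j = −528`; class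
  theorem `bsdp_three_of_unitRegime_chiFortyFour_263` for `d = 11` (`17424bb/be/bf`: `k = 44, 1331,
  11·484²`), bad primes `⊂ {2, 3, 11}`.
* §2 `ψ = (·/7)` (ODD, conductor `7`), `K = ℚ(√−47)` (`3`, `7` split): certificates
  `3 ∤ Σ_{j<7} (j/7)j = −7` and `3 ∥ Σ_{j<987} (j/7)(j/47)(j/3)j = −7896`; class theorem
  `bsdp_three_of_unitRegime_legendreSeven_47` for `d ∈ {−7, 21}` (`1323m`: `k = −112`; `11907r/s/t`:
  `k = 21·196², 21·4², 21·28²`), bad primes `⊂ {3, 7}`.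
Displayed binders = those of `bsdp_three_of_unitRegime_five_eleven` (p546876). Reach: 7 classes, all
regime N (p546152's criterion; `1323m`, `11907s` booked by print, the other 5 UNBOOKED before). With
`…PrimePairInstances` and `…KroneckerClasses` this gives every one of the 27 classes of the «3-unit
regime» (P3-UNIT-REGIME-CENSUS §0) a class theorem whose character side is in the kernel.
References: [KrizLi2019] Thm. 1.20 (pp. 7–8), Rem. 3.10 (p. 26), Thm. 1.23, §1.5 (1), §10.3;
[Washington1997] Thm. 4.2; [Cox2013] §1.C; [GrossZagier1986] V.§2; [Miller2011LMS] Def. 1.1.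
-/

set_option linter.dupNamespace false
set_option autoImplicit false

noncomputable section

open scoped Classical NumberTheorySymbols
open NumberField Field WeierstrassCurve DirichletCharacter
open Literature.NumberTheory.EllipticCurves Literature.NumberTheory.EllipticCurves.KrizLi2019
  Literature.NumberTheory.EllipticCurves.ModularForms Literature.NumberTheory.QuadraticFields
  Summit.BirchSwinnertonDyer.Rank1Residual.X12.O11.RouteU

namespace Summit.BirchSwinnertonDyer.BirchSwinnertonDyer.Theorems.PrintCFram

/-! ## §1 `ψ = χ₄₄`, `K = ℚ(√−263)` -/

set_option maxRecDepth 400000 in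
/-- **CERTIFICATE `3 ∤ Σ_{j<11572} χ₄(j)(j/11)(j/263)·j = −185152`** (`θ₁ = χ₄₄χ₂₆₃`, level `44·263`
prime to `3`; `h(−11572) = 32`… read as `S₁ = qr·B_{1,θ₁}`), `decide +kernel` on Euler's criterion in `ℕ`.
[cite: KrizLi2019, Thm. 1.20 (p. 8) and §1.5 (1)] [cite: Washington1997, Thm. 4.2] -/
theorem certOne_chiFortyFour_263 :
    ¬ ((3 : ℤ) ∣ ∑ j ∈ Finset.range (4 * 11 * 263),
      (ZMod.χ₄ (j : ZMod 4) * J((j : ℤ) | 11) : ℤ) * J((j : ℤ) | 263) * (j : ℤ)) := by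
  simp_rw [ZMod.χ₄_nat_eq_if_mod_four, jacobiSym_prime_eq_ite_nat 11 (by norm_num) (by norm_num),
    jacobiSym_prime_eq_ite_nat 263 (by norm_num) (by norm_num)]
  decide +kernel

set_option maxRecDepth 200000 in
/-- **CERTIFICATE `3 ∥ Σ_{j<132} χ₄(j)(j/11)(j/3)·j = −528`** (`θ₂ = χ₄₄ω`, level `132`).
[cite: KrizLi2019, Thm. 1.20 (p. 8) and §1.5 (1)] [cite: Washington1997, Thm. 4.2] -/
theorem certTwo_chiFortyFour :
    ((3 : ℤ) ∣ ∑ j ∈ Finset.range (4 * 11 * 3),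
      (ZMod.χ₄ (j : ZMod 4) * J((j : ℤ) | 11) : ℤ) * J((j : ℤ) | 3) * (j : ℤ) ^ (0 + 1)) ∧
    ¬ ((3 : ℤ) ^ 2 ∣ ∑ j ∈ Finset.range (4 * 11 * 3),
      (ZMod.χ₄ (j : ZMod 4) * J((j : ℤ) | 11) : ℤ) * J((j : ℤ) | 3) * (j : ℤ) ^ (0 + 1)) := by
  simp_rw [ZMod.χ₄_nat_eq_if_mod_four, jacobiSym_prime_eq_ite_nat 11 (by norm_num) (by norm_num),
    jacobiSym_prime_eq_ite_nat 3 (by norm_num) (by norm_num)]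
  constructor
  · decide +kernel
  · decide +kernel

/-- **BSD(W, 3) in the 3-UNIT REGIME for `ψ = χ₄₄`, `K = ℚ(√−263)`** [`17424bb/be/bf` (`d = 11`)] — for
every globally minimal `W/ℚ` of analytic rank one with `C • W = y² = x³ + 11·m²`, `11m²`
sixth-power-free, bad primes `⊂ {2, 3, 11}`, and `K` of discriminant `−263`:
`bsdp_three_of_unitRegime_valuePsi` with `ψ = χ₄₄` (`PrintCFram.exists_chiFortyFour_three`: primitive,
even, value `−1` at `3`, `χ₄(ℓ)J(ℓ | 11) = J(11 | ℓ)`), `ε_K = (·/263)↑`, and `hB` by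
`bernoulli_hypothesis_three_of_even_values` + the two certificates above.
[cite: KrizLi2019, Thm. 1.20 (pp. 7–8), Rem. 3.10 (p. 26), §10.3]
[cite: GrossZagier1986, V.§2 (pp. 310–312)] [cite: Miller2011LMS, Def. 1.1] -/
theorem bsdp_three_of_unitRegime_chiFortyFour_263
    (hKL : KrizLi2019.thm120_padicLogHeegner_unit_of_bernoulli)
    (hRem : KrizLi2019.rem310_padicLogHeegner_integral)
    (W : WeierstrassCurve ℚ) [W.IsElliptic] [W.IsGloballyMinimal] [NeZero (W.conductorNorm ℤ)]
    {d m : ℤ} (hdset : d = 11) (hm : m ≠ 0)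
    (hW : ∃ C : VariableChange ℚ, C • W = mordellCurve ((d : ℚ) * (m : ℚ) ^ 2))
    (h6 : ∀ ℓ : ℕ, ℓ.Prime → ¬ ((ℓ : ℤ) ^ 6 ∣ d * m ^ 2))
    (h2 : (haveI : Fact (Nat.Prime 2) := ⟨Nat.prime_two⟩; W.HasGoodReductionAtPrime 2) →
      W.LFunction 2 = 0)
    (hS : ∀ ℓ : ℕ, (hℓ : ℓ.Prime) → ¬ (haveI := Fact.mk hℓ; W.HasGoodReductionAtPrime ℓ) →
      ℓ = 2 ∨ ℓ = 3 ∨ ℓ = 11)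
    (K : Type) [Field K] [NumberField K] [NeZero (NumberField.discr K).natAbs]
    (hK : IsImaginaryQuadratic K) (hdK : NumberField.discr K = -263)
    (D : ModularParametrizationData W (W.conductorNorm ℤ))
    (H : HeegnerDatum (W.conductorNorm ℤ) (NumberField.discr K)) (ι : K →+* ℂ)
    (ιp : K →+* ℚ_[3]) (P : (W.baseChange K).toAffine.Point)
    (hGZ : gross_zagier (W.conductorNorm ℤ) W K) (hKo : kolyvagin (W.conductorNorm ℤ) W K)
    (hGZK : rank_eq_analyticRank_of_analyticRank_le_one) (hmod : hasEntireLFunction_rat)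
    (hP : WeierstrassCurve.Affine.Point.map ι.toRatAlgHom P = heegnerPointComplex D H)
    (hr : W.analyticRank = 1)
    (hLt : (W.quadraticTwist (NumberField.discr K : ℚ)).entireLFunction 1 ≠ 0)
    (Wd : WeierstrassCurve ℚ) [Wd.IsElliptic] [Wd.IsGloballyMinimal] (Cd : VariableChange ℚ)
    (hWd : Cd • W.quadraticTwist (NumberField.discr K : ℚ) = Wd)
    (htw : ∃ q : ℚ, Wd.entireLFunction 1 / (Wd.realPeriodRat : ℂ) = (q : ℂ) ∧
      padicValRat 3 q = (padicValNat 3 Wd.shaOrder : ℤ) + padicValNat 3 Wd.tamagawaProduct -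
        2 * padicValNat 3 Wd.torsionOrder)
    (htam : padicValNat 3 Wd.tamagawaProduct = padicValNat 3 W.tamagawaProduct)
    (hu : padicValRat 3 (Cd.u : ℚ) = 0)
    (htamW : ¬ 3 ∣ W.tamagawaProduct)
    (hSW : ∀ [Finite W.sha], ¬ 3 ∣ W.shaOrder) (hSd : ∀ [Finite Wd.sha], ¬ 3 ∣ Wd.shaOrder)
    (ω : DirichletCharacter ℚ_[3] 3) (hω : KrizLi2019.IsTeichmullerCharacter ω)
    [Finite (AddCommGroup.torsion (W.baseChange K).toAffine.Point)]
    (crd : (W.baseChange K).toAffine.Point →+ ℤ) (g : (W.baseChange K).toAffine.Point)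
    (hg : crd g = 1) (hker : ∀ x, crd x = 0 → IsOfFinAddOrder x)
    (hiv : ∀ x : (W.baseChange K).toAffine.Point, 3 • x = 0 → x = 0)
    (hg0 : ‖Castella2018.padicLogOmega W 3 ιp g‖ = 1) :
    BSDp W 3 := by
  haveI : Fact (Nat.Prime 263) := ⟨by norm_num⟩
  haveI : NeZero (4 * 11) := ⟨by norm_num⟩
  obtain ⟨χ, hχp, hχ2, hχ⟩ := exists_chiFortyFour_three
  obtain ⟨χr, hχr⟩ := exists_legendreCharacter_three 263
  have hrd : 263 ∣ (NumberField.discr K).natAbs := by rw [hdK]; decide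
  subst hdset
  have hsq : Squarefree (11 : ℤ) := by
    rw [← Int.squarefree_natAbs]; show Squarefree (11 : ℕ); exact (by norm_num : Nat.Prime 11).squarefree
  refine bsdp_three_of_unitRegime_valuePsi hKL hRem χ
    (fun a => (ZMod.χ₄ (a : ZMod 4) * J((a : ℤ) | 11) : ℤ)) hχ hχp hχ2 (by norm_num)
    chiFortyFour_val_three (r := 263) (by norm_num) (by norm_num) (by norm_num) (fun ℓ hℓ hℓf => ?_)
    χr hχr W hsq hm hW h6 (fun ℓ hℓ hℓ1 => ?_) h2 (fun ℓ hℓ hbad => ?_) K hK (by rw [hdK]; norm_num) hrd D H ι ιp P hGZ hKo hGZK hmod hP hr hLt Wd Cd hWd htw htam hu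
      htamW hSW hSd ω hω ?_ crd g hg hker hiv hg0
  · -- the conductor primes `2`, `11` split in `ℚ(√−263)`
    have h44 : ℓ ∣ 4 ∨ ℓ ∣ 11 := (Nat.Prime.dvd_mul hℓ).mp hℓf
    rcases h44 with h4 | h11
    · have h2' : ℓ = 2 :=
        (Nat.prime_dvd_prime_iff_eq hℓ Nat.prime_two).mp (hℓ.dvd_of_dvd_pow (n := 2) (by simpa using h4))
      exact ⟨fun _ => by norm_num, fun h => absurd h2' h⟩
    · have h11' : ℓ = 11 := (Nat.prime_dvd_prime_iff_eq hℓ (by norm_num)).mp h11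
      subst h11'
      exact ⟨fun h => by norm_num at h, fun _ => by norm_num⟩
  · exact chiFortyFour_eq_jacobiSym_eleven (hℓ.odd_of_ne_two (by omega))
  · rcases hS ℓ hℓ hbad with h | h | h
    · exact Or.inr (Or.inl (by rw [h]; norm_num))
    · exact Or.inl h
    · exact Or.inr (Or.inl (by rw [h]; norm_num))
  · exact bernoulli_hypothesis_three_of_even_values χ
      (fun a => (ZMod.χ₄ (a : ZMod 4) * J((a : ℤ) | 11) : ℤ)) χr ω hχ hχ2 hχp hχr hω (by norm_num)
      (by norm_num) (by norm_num) (by norm_num) hrd (chiFortyFour_even χ hχ) certOne_chiFortyFour_263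
      certTwo_chiFortyFour.1 certTwo_chiFortyFour.2

/-! ## §2 `ψ = (·/7)` (odd), `K = ℚ(√−47)` -/

set_option maxRecDepth 20000 in
/-- **CERTIFICATE `3 ∤ Σ_{j<7} (j/7)·j = −7`** (`‖B_{1,(·/7)}‖₃ = 1`: `B_{1,χ₋₇} = −h(−7) = −1`).
[cite: KrizLi2019, Thm. 1.20 (p. 8) and §1.5 (1)] [cite: Washington1997, Thm. 4.2] -/
theorem certOne_legendreSeven :
    ¬ ((3 : ℤ) ∣ ∑ j ∈ Finset.range 7, J((j : ℤ) | 7) * (j : ℤ)) := by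
  simp_rw [jacobiSym_prime_eq_ite_nat 7 (by norm_num) (by norm_num)]
  decide

set_option maxRecDepth 200000 in
/-- **CERTIFICATE `3 ∥ Σ_{j<987} (j/7)(j/47)(j/3)·j = −7896`** (`θ₂' = χ₋₇χ₄₇ω`, level `987`).
[cite: KrizLi2019, Thm. 1.20 (p. 8) and §1.5 (1)] [cite: Washington1997, Thm. 4.2] -/
theorem certTwo_legendreSeven_47 :
    ((3 : ℤ) ∣ ∑ j ∈ Finset.range (7 * 47 * 3),
      J((j : ℤ) | 7) * J((j : ℤ) | 47) * J((j : ℤ) | 3) * (j : ℤ) ^ (0 + 1)) ∧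
    ¬ ((3 : ℤ) ^ 2 ∣ ∑ j ∈ Finset.range (7 * 47 * 3),
      J((j : ℤ) | 7) * J((j : ℤ) | 47) * J((j : ℤ) | 3) * (j : ℤ) ^ (0 + 1)) := by
  simp_rw [jacobiSym_prime_eq_ite_nat 7 (by norm_num) (by norm_num),
    jacobiSym_prime_eq_ite_nat 47 (by norm_num) (by norm_num),
    jacobiSym_prime_eq_ite_nat 3 (by norm_num) (by norm_num)]
  constructor
  · decide +kernel
  · decide +kernel

/-- **BSD(W, 3) in the 3-UNIT REGIME for `ψ = (·/7)`, `K = ℚ(√−47)`** [`1323m` (`d = −7`), `11907r/s/t`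
(`d = 21`)] — for every globally minimal `W/ℚ` of analytic rank one with `C • W = y² = x³ + d·m²`,
`d ∈ {−7, 21}`, `dm²` sixth-power-free, bad primes `⊂ {3, 7}`, `a₂(W) = 0`, and `K` of discriminant
`−47`: `bsdp_three_of_unitRegime_valuePsi` with `ψ = (·/7)` (`PrintCFram.exists_legendreCharacter_three`;
primitive, odd, `J(3 | 7) = −1`, `J(ℓ | 7) = J(d | ℓ)` at `ℓ ≡ 1 (3)`), `ε_K = (·/47)↑`, and `hB` by
`bernoulli_hypothesis_three_of_odd_values` + the two certificates above.
[cite: KrizLi2019, Thm. 1.20 (pp. 7–8), Rem. 3.10 (p. 26), §10.3]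
[cite: GrossZagier1986, V.§2 (pp. 310–312)] [cite: Miller2011LMS, Def. 1.1] -/
theorem bsdp_three_of_unitRegime_legendreSeven_47
    (hKL : KrizLi2019.thm120_padicLogHeegner_unit_of_bernoulli)
    (hRem : KrizLi2019.rem310_padicLogHeegner_integral)
    (W : WeierstrassCurve ℚ) [W.IsElliptic] [W.IsGloballyMinimal] [NeZero (W.conductorNorm ℤ)]
    {d m : ℤ} (hdset : d = -7 ∨ d = 21) (hm : m ≠ 0)
    (hW : ∃ C : VariableChange ℚ, C • W = mordellCurve ((d : ℚ) * (m : ℚ) ^ 2))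
    (h6 : ∀ ℓ : ℕ, ℓ.Prime → ¬ ((ℓ : ℤ) ^ 6 ∣ d * m ^ 2))
    (h2 : (haveI : Fact (Nat.Prime 2) := ⟨Nat.prime_two⟩; W.HasGoodReductionAtPrime 2) →
      W.LFunction 2 = 0)
    (hS : ∀ ℓ : ℕ, (hℓ : ℓ.Prime) → ¬ (haveI := Fact.mk hℓ; W.HasGoodReductionAtPrime ℓ) →
      ℓ = 3 ∨ ℓ = 7)
    (K : Type) [Field K] [NumberField K] [NeZero (NumberField.discr K).natAbs]
    (hK : IsImaginaryQuadratic K) (hdK : NumberField.discr K = -47)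
    (D : ModularParametrizationData W (W.conductorNorm ℤ))
    (H : HeegnerDatum (W.conductorNorm ℤ) (NumberField.discr K)) (ι : K →+* ℂ)
    (ιp : K →+* ℚ_[3]) (P : (W.baseChange K).toAffine.Point)
    (hGZ : gross_zagier (W.conductorNorm ℤ) W K) (hKo : kolyvagin (W.conductorNorm ℤ) W K)
    (hGZK : rank_eq_analyticRank_of_analyticRank_le_one) (hmod : hasEntireLFunction_rat)
    (hP : WeierstrassCurve.Affine.Point.map ι.toRatAlgHom P = heegnerPointComplex D H)
    (hr : W.analyticRank = 1)
    (hLt : (W.quadraticTwist (NumberField.discr K : ℚ)).entireLFunction 1 ≠ 0)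
    (Wd : WeierstrassCurve ℚ) [Wd.IsElliptic] [Wd.IsGloballyMinimal] (Cd : VariableChange ℚ)
    (hWd : Cd • W.quadraticTwist (NumberField.discr K : ℚ) = Wd)
    (htw : ∃ q : ℚ, Wd.entireLFunction 1 / (Wd.realPeriodRat : ℂ) = (q : ℂ) ∧
      padicValRat 3 q = (padicValNat 3 Wd.shaOrder : ℤ) + padicValNat 3 Wd.tamagawaProduct -
        2 * padicValNat 3 Wd.torsionOrder)
    (htam : padicValNat 3 Wd.tamagawaProduct = padicValNat 3 W.tamagawaProduct)
    (hu : padicValRat 3 (Cd.u : ℚ) = 0)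
    (htamW : ¬ 3 ∣ W.tamagawaProduct)
    (hSW : ∀ [Finite W.sha], ¬ 3 ∣ W.shaOrder) (hSd : ∀ [Finite Wd.sha], ¬ 3 ∣ Wd.shaOrder)
    (ω : DirichletCharacter ℚ_[3] 3) (hω : KrizLi2019.IsTeichmullerCharacter ω)
    [Finite (AddCommGroup.torsion (W.baseChange K).toAffine.Point)]
    (crd : (W.baseChange K).toAffine.Point →+ ℤ) (g : (W.baseChange K).toAffine.Point)
    (hg : crd g = 1) (hker : ∀ x, crd x = 0 → IsOfFinAddOrder x)
    (hiv : ∀ x : (W.baseChange K).toAffine.Point, 3 • x = 0 → x = 0)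
    (hg0 : ‖Castella2018.padicLogOmega W 3 ιp g‖ = 1) :
    BSDp W 3 := by
  haveI : Fact (Nat.Prime 47) := ⟨by norm_num⟩
  obtain ⟨χ, hχ⟩ := exists_legendreCharacter_three 7
  obtain ⟨χr, hχr⟩ := exists_legendreCharacter_three 47
  have hrd : 47 ∣ (NumberField.discr K).natAbs := by rw [hdK]; decide
  have hχ' : ∀ a : ℕ, χ (a : ZMod 7) = ((J((a : ℤ) | 7) : ℤ) : ℚ_[3]) := fun a => by
    rw [hχ, jacobiSym.legendreSym.to_jacobiSym]
  have hsq : Squarefree d := by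
    rcases hdset with rfl | rfl <;> rw [← Int.squarefree_natAbs]
    · show Squarefree (7 : ℕ); exact (by norm_num : Nat.Prime 7).squarefree
    · show Squarefree (3 * 7 : ℕ)
      exact (Nat.squarefree_mul (by norm_num)).mpr
        ⟨Nat.prime_three.squarefree, (by norm_num : Nat.Prime 7).squarefree⟩
  refine bsdp_three_of_unitRegime_valuePsi hKL hRem χ (fun a => J((a : ℤ) | 7)) hχ'
    (legendreChar_three_isPrimitive χ hχ (by norm_num)) (legendreChar_three_mul_self χ hχ) (by norm_num)
    jacobiSym_seven_values.1 (r := 47) (by norm_num) (by norm_num) (by norm_num) (fun ℓ hℓ hℓf => ?_)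
    χr hχr W hsq hm hW h6 (fun ℓ hℓ hℓ1 => ?_) h2 (fun ℓ hℓ hbad => ?_) K hK (by rw [hdK]; norm_num) hrd D H ι ιp P hGZ hKo hGZK hmod hP hr hLt Wd Cd hWd htw htam hu
      htamW hSW hSd ω hω ?_ crd g hg hker hiv hg0
  · have h7 : ℓ = 7 := (Nat.prime_dvd_prime_iff_eq hℓ (by norm_num)).mp hℓf
    subst h7
    exact ⟨fun h => by norm_num at h, fun _ => by norm_num⟩
  · -- `J(ℓ | 7) = J(d | ℓ)` at `ℓ ≡ 1 (mod 3)` (at `ℓ = 7` both vanish)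
    have hodd : Odd ℓ := hℓ.odd_of_ne_two (by omega)
    by_cases h7 : ℓ = 7
    · subst h7; rcases hdset with rfl | rfl <;> norm_num
    · have hcop : ℓ.Coprime 7 := (Nat.coprime_primes hℓ (by norm_num)).mpr h7
      rcases hdset with rfl | rfl
      · exact (jacobiSym_seven_compat hodd hℓ1 hcop).1
      · exact (jacobiSym_seven_compat hodd hℓ1 hcop).2
  · rcases hS ℓ hℓ hbad with h | h
    · exact Or.inl h
    · exact Or.inr (Or.inl (by rw [h]))
  · exact bernoulli_hypothesis_three_of_odd_values χ (fun a => J((a : ℤ) | 7)) χr ω hχ'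
      (legendreChar_three_mul_self χ hχ) (legendreChar_three_isPrimitive χ hχ (by norm_num)) hχr hω
      (by norm_num) (by norm_num) (by norm_num) (by norm_num) hrd (legendreChar_seven_odd χ hχ)
      certOne_legendreSeven certTwo_legendreSeven_47.1 certTwo_legendreSeven_47.2

end Summit.BirchSwinnertonDyer.BirchSwinnertonDyer.Theorems.PrintCFram

end
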